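import Summits.KontsevichZagierPeriods.KontsevichZagierPeriods.Theorems.MultiplicationThree.Negative.Pinned
import Literature.NumberTheory.Transcendental.KZKernelConjectureForms
import Literature.Analysis.SpecialFunctions.GammaMultiplication

/-!
# `MultiplicationThree` (stmt-KontsevichZagierPeriods-3598) — negative knowledge, part 2: no evaluation kill

`value_eq`: any two representations satisfying the four pinning hypotheses of the crux have EQUAL
values for every rational `s > 0` — box `= Γ(1/3)Γ(s)/Γ(s+1/3)·Γ(2/3)Γ(s)/Γ(s+2/3)` (Fubini),
simplex `= 9·27^{s-1}·Γ(s)Γ(2s)/Γ(3s)·Γ(s)²/Γ(2s)` (chart `Φ` + Fubini), equal by the tree's Gauss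
multiplication formula (`GaussMultiplication.real_formula`, `n = 3`). Hence
`multiplicationThree_of_summit : KontsevichZagierPeriods → MultiplicationThree`: the crux is an
instance of the summit, the only proved invariant of `KZ.relations` (evaluation) cannot separate the
pair, and a refutation would refute Conjecture 1 as formalised. (cdisprove gen 1.)
-/

noncomputable section

open MeasureTheory Set Real
open scoped BigOperators

namespace Summit.KontsevichZagierPeriods.TerasomaMultiplication.MultiplicationThreeNegative

open Literature.NumberTheory.Transcendental
open Literature.NumberTheory.Transcendental.KZ
open Literature.ModelTheory.ExponentialFields (IsSemialgebraic)
open MvPolynomial (aeval X C)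
open Summit.KontsevichZagierPeriods.KontsevichZagierPeriods.Theses.TerasomaMultiplication
  (MultiplicationThree)

/-! ## §2 No evaluation kill: the two values agree (Euler–Gauss multiplication at `n = 3`) -/

/-- Euler's Beta integral on `(0,1)` (tree lemma, exponent form). [folklore] -/
theorem integral_beta {a b : ℝ} (ha : 0 < a) (hb : 0 < b) :
    ∫ t in Ioo (0:ℝ) 1, t ^ (a - 1) * (1 - t) ^ (b - 1) = Gamma a * Gamma b / Gamma (a + b) :=
  (Literature.Analysis.SpecialFunctions.Selberg.integrableOn_Ioo_rpow_mul_one_sub_rpow_and_integral_eq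
    ha hb).2

/-- **Value of the box side**: `∫_{(0,1)²} v₁^{-2/3}(1-v₁)^{s-1}v₂^{-1/3}(1-v₂)^{s-1}
= B(1/3, s) · B(2/3, s)` (Fubini on the product box). [folklore] -/
theorem integral_box_boxFun {s : ℚ} (hs : 0 < s) :
    ∫ x in box, boxFun s x =
      (Gamma (1/3) * Gamma s / Gamma (1/3 + s)) * (Gamma (2/3) * Gamma s / Gamma (2/3 + s)) := by
  have hsR : (0:ℝ) < s := by exact_mod_cast hs
  simp_rw [boxFun_eq_prod]
  rw [volume_restrict_box, integral_fintype_prod_eq_prod (𝕜 := ℝ) (fun i => boxFactor s i),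
    Fin.prod_univ_two]
  have e0 : boxFactor s 0 = fun t => t ^ ((1/3:ℝ) - 1) * (1 - t) ^ ((s:ℝ) - 1) := by
    funext t; simp only [boxFactor, Matrix.cons_val_zero]; norm_num
  have e1 : boxFactor s 1 = fun t => t ^ ((2/3:ℝ) - 1) * (1 - t) ^ ((s:ℝ) - 1) := by
    funext t; simp only [boxFactor, Matrix.cons_val_one, Matrix.cons_val_zero]; norm_num
  rw [e0, e1, integral_beta (by norm_num) hsR, integral_beta (by norm_num) hsR]

/-- **Value of the simplex side**: `∫_{triangle} (σ₁σ₂(3-σ₁-σ₂))^{s-1} = 9·27^{s-1}·B(s,2s)·B(s,s)`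
(change of variables along `Φ`, then Fubini). [folklore] -/
theorem integral_triangle_simplexFun {s : ℚ} (hs : 0 < s) :
    ∫ x in triangle, simplexFun s x =
      pullConst s * ((Gamma s * Gamma (2 * s) / Gamma (s + 2 * s)) *
        (Gamma s * Gamma s / Gamma (s + s))) := by
  have hsR : (0:ℝ) < s := by exact_mod_cast hs
  rw [← image_Φ_box, integral_image_eq_integral_abs_det_fderiv_smul volume measurableSet_box
    (fun x _ => (hasFDerivAt_Φ x).hasFDerivWithinAt) injOn_Φ]
  rw [setIntegral_congr_fun measurableSet_box (fun x hx => by rw [smul_eq_mul, pullback_eq hx]),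
    integral_const_mul, volume_restrict_box,
    integral_fintype_prod_eq_prod (𝕜 := ℝ) (fun i => pullFactor s i), Fin.prod_univ_two]
  have e0 : pullFactor s 0 = fun t => t ^ ((s:ℝ) - 1) * (1 - t) ^ (2 * (s:ℝ) - 1) := rfl
  have e1 : pullFactor s 1 = fun t => t ^ ((s:ℝ) - 1) * (1 - t) ^ ((s:ℝ) - 1) := rfl
  rw [e0, e1, integral_beta hsR (by positivity), integral_beta hsR hsR]

/-- Gauss's multiplication formula at `n = 3`, real form (tree theorem
`Literature.Analysis.SpecialFunctions.GaussMultiplication.real_formula`):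
`Γ(x)Γ(x+1/3)Γ(x+2/3)·3^{3x} = Γ(3x)·√3·2π` for `x > 0`. [cite: AndrewsAskeyRoy1999, Thm 1.5.2] -/
theorem gauss_three {x : ℝ} (hx : 0 < x) :
    Gamma x * Gamma (x + 1/3) * Gamma (x + 2/3) * (3:ℝ) ^ ((3:ℝ) * x) =
      Gamma (3 * x) * (Real.sqrt 3 * (2 * π)) := by
  have h := Literature.Analysis.SpecialFunctions.GaussMultiplication.real_formula (n := 3)
    (by norm_num) hx
  simp only [Literature.Analysis.SpecialFunctions.GaussMultiplication.prodGamma,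
    Finset.prod_range_succ, Finset.prod_range_zero, one_mul, Nat.cast_zero, zero_div, add_zero,
    Nat.cast_one, Nat.cast_ofNat] at h
  have h2 : (2 * π : ℝ) ^ (((3:ℝ) - 1) / 2) = 2 * π := by norm_num
  rw [h2] at h
  linear_combination h

/-- `Γ(1/3)Γ(2/3) = 2π/√3`, i.e. `3·Γ(1/3)Γ(2/3) = √3·2π` (`gauss_three` at `x = 1/3`; this is
also Euler's reflection at `1/3`). [cite: AndrewsAskeyRoy1999, Thm 1.5.2] -/
theorem gamma_third_mul_gamma_two_thirds :
    Gamma (1/3) * Gamma (2/3) * 3 = Real.sqrt 3 * (2 * π) := by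
  have h := gauss_three (x := 1/3) (by norm_num)
  have e1 : (1/3 : ℝ) + 1/3 = 2/3 := by norm_num
  have e2 : (1/3 : ℝ) + 2/3 = 1 := by norm_num
  have e3 : (3:ℝ) * (1/3) = 1 := by norm_num
  rw [e1, e2, e3, Real.rpow_one, Gamma_one, mul_one, one_mul] at h
  exact h

/-- `27^{s-1} · 27 = 3^{3s}`. [folklore] -/
theorem pullConst_mul (s : ℚ) : pullConst s * 3 = (3:ℝ) ^ ((3:ℝ) * s) := by
  unfold pullConst
  rw [Real.rpow_sub_one (by norm_num), Real.rpow_mul (by norm_num)]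
  have : (3:ℝ) ^ (3:ℝ) = 27 := by norm_num
  rw [this]
  ring

/-- **The two values agree**: `B(1/3,s)B(2/3,s) = 9·27^{s-1}·B(s,2s)B(s,s)`
(`= 3^{3s-1}Γ(s)³/Γ(3s)`), by Gauss multiplication at `n = 3`. So the only PROVED invariant of
`KZ.relations`, evaluation, cannot separate the pair. [cite: AndrewsAskeyRoy1999, Thm 1.5.2] -/
theorem boxValue_eq_simplexValue {s : ℚ} (hs : 0 < s) :
    (Gamma (1/3) * Gamma s / Gamma (1/3 + s)) * (Gamma (2/3) * Gamma s / Gamma (2/3 + s)) =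
      pullConst s * ((Gamma s * Gamma (2 * s) / Gamma (s + 2 * s)) *
        (Gamma s * Gamma s / Gamma (s + s))) := by
  have hsR : (0:ℝ) < s := by exact_mod_cast hs
  have F1 := gauss_three hsR
  have F2 := gamma_third_mul_gamma_two_thirds
  have F3 := pullConst_mul s
  have hG : 0 < Gamma (s:ℝ) := Gamma_pos_of_pos hsR
  have hG1 : 0 < Gamma ((s:ℝ) + 1/3) := Gamma_pos_of_pos (by positivity)
  have hG2 : 0 < Gamma ((s:ℝ) + 2/3) := Gamma_pos_of_pos (by positivity)
  have hG3 : 0 < Gamma (3 * (s:ℝ)) := Gamma_pos_of_pos (by positivity)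
  have hG2s : 0 < Gamma (2 * (s:ℝ)) := Gamma_pos_of_pos (by positivity)
  have hT : 0 < (3:ℝ) ^ ((3:ℝ) * s) := Real.rpow_pos_of_pos (by norm_num) _
  have e1 : (1/3 : ℝ) + s = s + 1/3 := add_comm _ _
  have e2 : (2/3 : ℝ) + s = s + 2/3 := add_comm _ _
  have e3 : (s : ℝ) + 2 * s = 3 * s := by ring
  have e4 : (s : ℝ) + s = 2 * s := by ring
  rw [e1, e2, e3, e4]
  have nG : Gamma (s:ℝ) ≠ 0 := hG.ne'
  have nG1 : Gamma ((s:ℝ) + 1/3) ≠ 0 := hG1.ne'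
  have nG2 : Gamma ((s:ℝ) + 2/3) ≠ 0 := hG2.ne'
  have nG3 : Gamma (3 * (s:ℝ)) ≠ 0 := hG3.ne'
  have nG2s : Gamma (2 * (s:ℝ)) ≠ 0 := hG2s.ne'
  have hP : pullConst s = (3:ℝ) ^ ((3:ℝ) * s) / 3 := by rw [← F3]; ring
  rw [hP]
  field_simp
  have e5 : (3 * (s:ℝ) + 1) / 3 = s + 1/3 := by ring
  have e6 : (3 * (s:ℝ) + 2) / 3 = s + 2/3 := by ring
  rw [e5, e6]
  linear_combination Gamma (3 * (s:ℝ)) * F2 - F1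


/-- Value of the pinned box representation. [folklore] -/
theorem boxRep_value {s : ℚ} (hs : 0 < s) :
    (boxRep s hs).value =
      (Gamma (1/3) * Gamma s / Gamma (1/3 + s)) * (Gamma (2/3) * Gamma s / Gamma (2/3 + s)) :=
  integral_box_boxFun hs

/-- Value of the pinned simplex representation. [folklore] -/
theorem simplexRep_value {s : ℚ} (hs : 0 < s) :
    (simplexRep s hs).value =
      pullConst s * ((Gamma s * Gamma (2 * s) / Gamma (s + 2 * s)) *
        (Gamma s * Gamma s / Gamma (s + s))) :=
  integral_triangle_simplexFun hs

/-- **NO EVALUATION KILL.** Any two representations satisfying the four pinning hypotheses of the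
crux have the SAME value (`B(1/3,s)B(2/3,s) = 3^{3s-1}Γ(s)³/Γ(3s)` = the Dirichlet integral over
the triangle of side 3). Since `KZ.relations ≤ ker eval` (`KZ.relations_le_ker_eval_holds`) is the
only separation tool proved in the tree, no refutation by value exists, for any `s`.
[cite: AndrewsAskeyRoy1999, Thm 1.5.2] -/
theorem value_eq {s : ℚ} (hs : 0 < s) (r r' : IntegralRep 2) (hr : r.domain = box)
    (hri : EqOn r.integrand (boxFun s) r.domain) (hr' : r'.domain = triangle)
    (hri' : EqOn r'.integrand (simplexFun s) r'.domain) : r.value = r'.value := by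
  simp only [IntegralRep.value]
  rw [hr] at hri ⊢
  rw [hr'] at hri' ⊢
  rw [setIntegral_congr_fun measurableSet_box hri, setIntegral_congr_fun measurableSet_triangle hri',
    integral_box_boxFun hs, integral_triangle_simplexFun hs, boxValue_eq_simplexValue hs]

/-- **The crux is an instance of the summit** (so refuting it refutes Conjecture 1 as formalised):
Conjecture 1 for KZ-rational representations (`KontsevichZagierPeriods`) implies it for all
`ℚ`-semialgebraic ones (`kzPeriodConjecture'_iff_isRational`, via the PROVED
`KZ.exists_isRational_equivalent_holds` + soundness), and the two pinned representations have equal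
values (`value_eq`). [cite: KontsevichZagier2001, §1.2 Conjecture 1] -/
theorem multiplicationThree_of_summit (h : _root_.KontsevichZagierPeriods) : MultiplicationThree := by
  have h' : Literature.NumberTheory.Transcendental.KZPeriodConjecture' :=
    kzPeriodConjecture'_iff_isRational.mpr (KontsevichZagierPeriods_iff.mp h)
  intro s hs r r' hr hri hr' hri'
  exact h' r r' (value_eq hs r r' hr hri hr' hri')

end Summit.KontsevichZagierPeriods.TerasomaMultiplication.MultiplicationThreeNegative
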